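import Literature.AnabelianGeometry.SemiGraphs.PSCTwoComponentUnmarkedEdges
import Literature.AnabelianGeometry.SemiGraphs.PSCTwoComponentAffinePointedOrigin
import HarnessLib

/-!
# [CombGC] Prop. 1.2 (i), [IUTchI] Rmk. 1.2.3 (iv) (cuspidal), [CombGC] Thm. 1.6 (i) at two-component data with one unmarked component

Mochizuki, *A combinatorial version of the Grothendieck conjecture* [CombGC] §1: Prop. 1.2 (i) p. 8, Thm.
1.6 (i) p. 13; *Inter-universal Teichmüller theory I* [IUTchI] Rmk. 1.2.3 (iv) pp. 41–42
[cite: MochizukiCombGC2007, Thm 1.6(i) p.13] [cite: MochizukiCombGC2007, Prop 1.2(i) p.8]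
[cite: Mochizuki2012, IUTchI Rmk 1.2.3(iv) pp.41-42].  PROOF-ONLY assembly (abc-iut-f-164 gen 2; rows F-0459
`PSCDatum.OpenInterDeterminesComponentHolds`, F-1931 `PSCDatum.CuspidalEdgeLikeCharacterizationHolds`, F-0458
`PSCDatum.NumericallyCuspidalIffHolds`) for the data of TWO-COMPONENT AFFINE SHAPE WITH `C₁` UNMARKED
(`s = 0`): a stable pointed component `C₀` (genus `g₀`, all `r ≥ 1` marked points, `2g₀ + r ≥ 2`) glued at
one node to a CLOSED component `C₁` of genus `g − g₀ ≥ 1`, over a pro-`Σ` completion `ι : Γ_{g,r} → Π`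
(shape hypotheses as in `PSCTwoComponentAffineShape.lean`).  Together with `PSCTwoComponentAffinePointedOrigin.lean`
(both components marked) this settles the three rows at EVERY shape of a pointed stable curve with two
components, one node and at least one marked point (up to relabelling the two blocks of handles).

* `openInterDeterminesComponent_of_twoComponentUnmarked`: Prop. 1.2 (i), all three cases (verticial:
  `verticialOpenInterDeterminesVertex_of_twoComponentAffine'`, whose hypotheses allow `s = 0`; edge-like:
  `PSCTwoComponentUnmarkedEdges.lean`; unramified: unchanged).
* `openInterDeterminesComponentHolds_of_twoComponentUnmarked`, `numericallyCuspidalIffHolds_of_twoComponentUnmarked`: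
  F-0459 and F-0458 (`Σ = {l}`) at every origin of such data; F-1931 there is the vertex-free
  `cuspidalEdgeLikeCharacterizationHolds_of_cuspidallyStandard`.
* `exists_twoComponentUnmarkedOrigin_thm16i_holds`: for a prime `l`, the origin of these data with `Σ = {l}`
  satisfies F-0459 ∧ F-1931 ∧ F-0458 and is INHABITED by the pro-`l` datum "TWO ELLIPTIC CURVES, ONE
  POINTED": `Γ_{2,1}` split as a genus-`1` component carrying the marked point glued to a closed genus-`1`
  component (the stable reduction of a one-pointed genus-2 curve acquiring a separating node) — the case
  needing two active handles.

Instance forms at data of the shape of genuine two-component curves; consistency evidence for the typed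
rows, not the printed theorems for all pointed stable curves.  Nothing here takes a side on [IUTchIII]
Cor. 3.12.
-/

noncomputable section

namespace Literature.AnabelianGeometry.SemiGraphs

open scoped Pointwise
open Literature.GroupTheory.CombinatorialGroupTheory
open SemiGraphOfAnabelioids (IsProSigmaCompletion)

universe u

namespace PSCDatum

section Shape

variable {P : Type u} [Group P] [TopologicalSpace P] [IsTopologicalGroup P]
variable [CompactSpace P] [T2Space P] [TotallyDisconnectedSpace P] {Sigma : Set ℕ} {g r : ℕ}

/-- **[CombGC] Prop. 1.2 (i) — all three cases — at every datum of two-component affine shape with `C₁`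
unmarked** (`s = 0`, `r ≥ 1`, `C₀` stable, `C₁` of genus `≥ 1`; the unramified case for sturdy data).
[cite: MochizukiCombGC2007, Prop 1.2(i) p.8] -/
theorem openInterDeterminesComponent_of_twoComponentUnmarked (hne : Sigma.Nonempty)
    (hprime : ∀ p ∈ Sigma, p.Prime) (ι : PuncturedSurfaceGroup g r →* P)
    (hι : IsProSigmaCompletion Sigma ι) (G : PSCDatum P) {g₀ s : ℕ} (hg₀ : g₀ ≤ g) (hs : s = 0)
    (hr : 1 ≤ r) (hst₀ : 1 ≤ g₀ ∨ 2 ≤ r) (hg₁ : 1 ≤ g - g₀) (e : G.graph.C ≃ Fin r)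
    (hC : ∀ c, G.cuspGp c =
      ((PuncturedSurfaceGroup.cuspInertia (g := g) (e c)).map ι).topologicalClosure)
    (v₀ v₁ : G.graph.V) (hV : ∀ w, w = v₀ ∨ w = v₁) (ε : PuncturedSurfaceGroup g r)
    (hε : ε = ((List.finRange r).map fun j : Fin r =>
            if s ≤ (j : ℕ) then PuncturedSurfaceGroup.c (g := g) j else 1).prod *
          ((List.finRange g).map fun i : Fin g => if (i : ℕ) < g₀ then
            PuncturedSurfaceGroup.a (r := r) i * PuncturedSurfaceGroup.b i *
              (PuncturedSurfaceGroup.a i)⁻¹ * (PuncturedSurfaceGroup.b i)⁻¹ else 1).prod)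
    (hV₀ : G.vertGp v₀ = ((Subgroup.closure {x : PuncturedSurfaceGroup g r |
            (∃ i : Fin g, (i : ℕ) < g₀ ∧ (x = PuncturedSurfaceGroup.a i ∨ x = PuncturedSurfaceGroup.b i)) ∨
            ∃ j : Fin r, s ≤ (j : ℕ) ∧ x = PuncturedSurfaceGroup.c j}).map ι).topologicalClosure)
    (hV₁ : G.vertGp v₁ = ((Subgroup.closure {x : PuncturedSurfaceGroup g r |
            (∃ i : Fin g, g₀ ≤ (i : ℕ) ∧ (x = PuncturedSurfaceGroup.a i ∨ x = PuncturedSurfaceGroup.b i)) ∨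
            (∃ j : Fin r, (j : ℕ) < s ∧ x = PuncturedSurfaceGroup.c j) ∨ x = ε}).map ι).topologicalClosure)
    (n₀ : G.graph.N) (hN : ∀ n, n = n₀)
    (hE : G.nodeGp n₀ = ((Subgroup.zpowers ε).map ι).topologicalClosure)
    (hgen₀ : G.genus v₀ = g₀) (hgen₁ : G.genus v₁ = g - g₀) :
    G.VerticialOpenInterDeterminesVertex ∧ G.EdgeLikeOpenInterDeterminesEdge ∧
      G.UnrVerticialOpenInterDeterminesVertex :=
  ⟨G.verticialOpenInterDeterminesVertex_of_twoComponentAffine' hne hprime ι hι hg₀ (by omega)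
      (by omega) (Or.inl hg₁) v₀ v₁ hV ε hε hV₀ hV₁,
    G.edgeLikeOpenInterDeterminesEdge_of_twoComponentUnmarked hne hprime ι hι hg₀ hs hr hst₀ hg₁ e hC ε hε
      n₀ hN hE,
    G.unrVerticialOpenInterDeterminesVertex_of_twoComponentAffine hne hprime ι hι hg₀ e hC v₀ v₁ hV ε
      hε hV₀ hV₁ n₀ hN hE hgen₀ hgen₁⟩

end Shape

/-! ### F-0459 and F-0458 at origins of two-component data with one unmarked component -/

section Origin

variable (Ω : PSCOrigin.{u}) (l : ℕ)

/-- **F-0459 / [CombGC] Prop. 1.2 (i) at every origin whose data are of two-component affine shape with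
`C₁` unmarked** (profinite `Π`). [cite: MochizukiCombGC2007, Prop 1.2(i) p.8] -/
theorem openInterDeterminesComponentHolds_of_twoComponentUnmarked
    (hΩ : ∀ ⦃Q : Type u⦄ [Group Q] [TopologicalSpace Q] [IsTopologicalGroup Q] (G : PSCDatum Q),
      Ω.IsOfPSCType G → CompactSpace Q ∧ T2Space Q ∧ TotallyDisconnectedSpace Q ∧
        ∃ (S : Set ℕ) (g r g₀ s : ℕ) (ι : PuncturedSurfaceGroup g r →* Q) (e : G.graph.C ≃ Fin r)
          (v₀ v₁ : G.graph.V) (n₀ : G.graph.N) (ε : PuncturedSurfaceGroup g r),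
          S.Nonempty ∧ (∀ p ∈ S, p.Prime) ∧ IsProSigmaCompletion S ι ∧ g₀ ≤ g ∧ s = 0 ∧ 1 ≤ r ∧
          (1 ≤ g₀ ∨ 2 ≤ r) ∧ 1 ≤ g - g₀ ∧
          (∀ c, G.cuspGp c =
            ((PuncturedSurfaceGroup.cuspInertia (g := g) (e c)).map ι).topologicalClosure) ∧
          (∀ w, w = v₀ ∨ w = v₁) ∧ (∀ n, n = n₀) ∧
          ε = ((List.finRange r).map fun j : Fin r =>
            if s ≤ (j : ℕ) then PuncturedSurfaceGroup.c (g := g) j else 1).prod *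
          ((List.finRange g).map fun i : Fin g => if (i : ℕ) < g₀ then
            PuncturedSurfaceGroup.a (r := r) i * PuncturedSurfaceGroup.b i *
              (PuncturedSurfaceGroup.a i)⁻¹ * (PuncturedSurfaceGroup.b i)⁻¹ else 1).prod ∧
          G.vertGp v₀ = ((Subgroup.closure {x : PuncturedSurfaceGroup g r |
            (∃ i : Fin g, (i : ℕ) < g₀ ∧ (x = PuncturedSurfaceGroup.a i ∨ x = PuncturedSurfaceGroup.b i)) ∨
            ∃ j : Fin r, s ≤ (j : ℕ) ∧ x = PuncturedSurfaceGroup.c j}).map ι).topologicalClosure ∧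
          G.vertGp v₁ = ((Subgroup.closure {x : PuncturedSurfaceGroup g r |
            (∃ i : Fin g, g₀ ≤ (i : ℕ) ∧ (x = PuncturedSurfaceGroup.a i ∨ x = PuncturedSurfaceGroup.b i)) ∨
            (∃ j : Fin r, (j : ℕ) < s ∧ x = PuncturedSurfaceGroup.c j) ∨ x = ε}).map ι).topologicalClosure ∧
          G.nodeGp n₀ = ((Subgroup.zpowers ε).map ι).topologicalClosure ∧
          G.genus v₀ = g₀ ∧ G.genus v₁ = g - g₀) :
    OpenInterDeterminesComponentHolds Ω := by
  intro Q _ _ _ G hG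
  obtain ⟨hc, ht, hd, S, g, r, g₀, s, ι, e, v₀, v₁, n₀, ε, hne, hprime, hι, hg₀, hs, hr, hst₀, hg₁, hC,
    hV, hN, hε, hV₀, hV₁, hE, hgen₀, hgen₁⟩ := hΩ G hG
  exact G.openInterDeterminesComponent_of_twoComponentUnmarked hne hprime ι hι hg₀ hs hr hst₀ hg₁ e hC
    v₀ v₁ hV ε hε hV₀ hV₁ n₀ hN hE hgen₀ hgen₁

/-- **F-0458 / [CombGC] Thm. 1.6 (i) as printed at every origin whose data are of two-component affine
shape with `C₁` unmarked, `Σ = {l}`** (abc-iut-f-164's reduction `numericallyCuspidalIffHolds_of_characterization`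
from F-0459 above and the vertex-free F-1931 `cuspidalEdgeLikeCharacterizationHolds_of_cuspidallyStandard`).
[cite: MochizukiCombGC2007, Thm 1.6(i) p.13] -/
theorem numericallyCuspidalIffHolds_of_twoComponentUnmarked
    (hΩ : ∀ ⦃Q : Type u⦄ [Group Q] [TopologicalSpace Q] [IsTopologicalGroup Q] (G : PSCDatum Q),
      Ω.IsOfPSCType G → CompactSpace Q ∧ T2Space Q ∧ TotallyDisconnectedSpace Q ∧
        ∃ (S : Set ℕ) (g r g₀ s : ℕ) (ι : PuncturedSurfaceGroup g r →* Q) (e : G.graph.C ≃ Fin r)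
          (v₀ v₁ : G.graph.V) (n₀ : G.graph.N) (ε : PuncturedSurfaceGroup g r),
          S.Nonempty ∧ (∀ p ∈ S, p.Prime) ∧ IsProSigmaCompletion S ι ∧ g₀ ≤ g ∧ s = 0 ∧ 1 ≤ r ∧
          (1 ≤ g₀ ∨ 2 ≤ r) ∧ 1 ≤ g - g₀ ∧
          (∀ c, G.cuspGp c =
            ((PuncturedSurfaceGroup.cuspInertia (g := g) (e c)).map ι).topologicalClosure) ∧
          (∀ w, w = v₀ ∨ w = v₁) ∧ (∀ n, n = n₀) ∧
          ε = ((List.finRange r).map fun j : Fin r =>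
            if s ≤ (j : ℕ) then PuncturedSurfaceGroup.c (g := g) j else 1).prod *
          ((List.finRange g).map fun i : Fin g => if (i : ℕ) < g₀ then
            PuncturedSurfaceGroup.a (r := r) i * PuncturedSurfaceGroup.b i *
              (PuncturedSurfaceGroup.a i)⁻¹ * (PuncturedSurfaceGroup.b i)⁻¹ else 1).prod ∧
          G.vertGp v₀ = ((Subgroup.closure {x : PuncturedSurfaceGroup g r |
            (∃ i : Fin g, (i : ℕ) < g₀ ∧ (x = PuncturedSurfaceGroup.a i ∨ x = PuncturedSurfaceGroup.b i)) ∨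
            ∃ j : Fin r, s ≤ (j : ℕ) ∧ x = PuncturedSurfaceGroup.c j}).map ι).topologicalClosure ∧
          G.vertGp v₁ = ((Subgroup.closure {x : PuncturedSurfaceGroup g r |
            (∃ i : Fin g, g₀ ≤ (i : ℕ) ∧ (x = PuncturedSurfaceGroup.a i ∨ x = PuncturedSurfaceGroup.b i)) ∨
            (∃ j : Fin r, (j : ℕ) < s ∧ x = PuncturedSurfaceGroup.c j) ∨ x = ε}).map ι).topologicalClosure ∧
          G.nodeGp n₀ = ((Subgroup.zpowers ε).map ι).topologicalClosure ∧
          G.genus v₀ = g₀ ∧ G.genus v₁ = g - g₀)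
    (hSig : ∀ ⦃Q : Type u⦄ [Group Q] [TopologicalSpace Q] [IsTopologicalGroup Q] (G : PSCDatum Q),
      Ω.IsOfPSCType G → G.Sigma = {l}) :
    NumericallyCuspidalIffHolds Ω :=
  numericallyCuspidalIffHolds_of_characterization Ω l
    (fun _ _ _ _ G hG => ⟨(hΩ G hG).1, (hΩ G hG).2.2.1⟩) hSig
    (openInterDeterminesComponentHolds_of_twoComponentUnmarked Ω hΩ)
    (cuspidalEdgeLikeCharacterizationHolds_of_cuspidallyStandard Ω fun Q _ _ _ G hG => by
      obtain ⟨hc, ht, hd, S, g, r, g₀, s, ι, e, v₀, v₁, n₀, ε, hne, hprime, hι, hg₀, hs, hr, hst₀, hg₁,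
        hC, -⟩ := hΩ G hG
      exact ⟨hc, ht, hd, S, g, r, ι, e, hne, hprime,
        by unfold PuncturedSurfaceGroup.IsHyperbolicType; omega, hι, hC⟩)

end Origin

/-! ### The origin with `Σ = {l}`, inhabited by two elliptic curves, one pointed -/

/-- **At the origin of two-component affine data with `C₁` unmarked and `Σ = {l}` — inhabited by the
pro-`l` datum "two elliptic curves meeting at a node, the single marked point on `C₀`" (`Γ_{2,1}`,
`g₀ = 1`, `s = 0`, `r = 1`) — F-0459, F-1931 and F-0458 all HOLD.**  Instance forms at data of the shape
of genuine two-component curves, not the printed theorems for all pointed stable curves.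
[cite: MochizukiCombGC2007, Thm 1.6(i) p.13] [cite: MochizukiCombGC2007, Prop 1.2(i) p.8]
[cite: Mochizuki2012, IUTchI Rmk 1.2.3(iv) pp.41-42] -/
theorem exists_twoComponentUnmarkedOrigin_thm16i_holds (l : ℕ) (hl : l.Prime) :
    ∃ Ω : PSCOrigin.{0},
      (∃ (Q : ProfiniteGrp.{0}) (ι : PuncturedSurfaceGroup 2 1 →* Q) (G : PSCDatum Q)
        (e : G.graph.C ≃ Fin 1) (v₀ v₁ : G.graph.V),
        IsProSigmaCompletion {l} ι ∧ Ω.IsOfPSCType G ∧ G.Sigma = {l} ∧ G.graph.i = 2 ∧ G.graph.n = 1 ∧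
          G.graph.r = 1 ∧ (∀ w, w = v₀ ∨ w = v₁) ∧ G.genus v₀ = 1 ∧ G.genus v₁ = 1 ∧
          (∀ c, ¬ G.graph.cuspEnd c = v₁) ∧
          ∀ c, G.cuspGp c =
            ((PuncturedSurfaceGroup.cuspInertia (g := 2) (e c)).map ι).topologicalClosure) ∧
      OpenInterDeterminesComponentHolds Ω ∧ CuspidalEdgeLikeCharacterizationHolds Ω ∧
      NumericallyCuspidalIffHolds Ω := by
  classical
  let Ω : PSCOrigin.{0} :=
    ⟨fun {Q} _ _ G => ∃ (_ : IsTopologicalGroup Q), G.Sigma = {l} ∧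
      (CompactSpace Q ∧ T2Space Q ∧ TotallyDisconnectedSpace Q ∧
        ∃ (S : Set ℕ) (g r g₀ s : ℕ) (ι : PuncturedSurfaceGroup g r →* Q) (e : G.graph.C ≃ Fin r)
          (v₀ v₁ : G.graph.V) (n₀ : G.graph.N) (ε : PuncturedSurfaceGroup g r),
          S.Nonempty ∧ (∀ p ∈ S, p.Prime) ∧ IsProSigmaCompletion S ι ∧ g₀ ≤ g ∧ s = 0 ∧ 1 ≤ r ∧
          (1 ≤ g₀ ∨ 2 ≤ r) ∧ 1 ≤ g - g₀ ∧
          (∀ c, G.cuspGp c =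
            ((PuncturedSurfaceGroup.cuspInertia (g := g) (e c)).map ι).topologicalClosure) ∧
          (∀ w, w = v₀ ∨ w = v₁) ∧ (∀ n, n = n₀) ∧
          ε = ((List.finRange r).map fun j : Fin r =>
            if s ≤ (j : ℕ) then PuncturedSurfaceGroup.c (g := g) j else 1).prod *
          ((List.finRange g).map fun i : Fin g => if (i : ℕ) < g₀ then
            PuncturedSurfaceGroup.a (r := r) i * PuncturedSurfaceGroup.b i *
              (PuncturedSurfaceGroup.a i)⁻¹ * (PuncturedSurfaceGroup.b i)⁻¹ else 1).prod ∧
          G.vertGp v₀ = ((Subgroup.closure {x : PuncturedSurfaceGroup g r |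
            (∃ i : Fin g, (i : ℕ) < g₀ ∧ (x = PuncturedSurfaceGroup.a i ∨ x = PuncturedSurfaceGroup.b i)) ∨
            ∃ j : Fin r, s ≤ (j : ℕ) ∧ x = PuncturedSurfaceGroup.c j}).map ι).topologicalClosure ∧
          G.vertGp v₁ = ((Subgroup.closure {x : PuncturedSurfaceGroup g r |
            (∃ i : Fin g, g₀ ≤ (i : ℕ) ∧ (x = PuncturedSurfaceGroup.a i ∨ x = PuncturedSurfaceGroup.b i)) ∨
            (∃ j : Fin r, (j : ℕ) < s ∧ x = PuncturedSurfaceGroup.c j) ∨ x = ε}).map ι).topologicalClosure ∧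
          G.nodeGp n₀ = ((Subgroup.zpowers ε).map ι).topologicalClosure ∧
          G.genus v₀ = g₀ ∧ G.genus v₁ = g - g₀)⟩
  have hΩ : ∀ ⦃Q : Type⦄ [Group Q] [TopologicalSpace Q] [IsTopologicalGroup Q] (G : PSCDatum Q),
      Ω.IsOfPSCType G → CompactSpace Q ∧ T2Space Q ∧ TotallyDisconnectedSpace Q ∧
        ∃ (S : Set ℕ) (g r g₀ s : ℕ) (ι : PuncturedSurfaceGroup g r →* Q) (e : G.graph.C ≃ Fin r)
          (v₀ v₁ : G.graph.V) (n₀ : G.graph.N) (ε : PuncturedSurfaceGroup g r),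
          S.Nonempty ∧ (∀ p ∈ S, p.Prime) ∧ IsProSigmaCompletion S ι ∧ g₀ ≤ g ∧ s = 0 ∧ 1 ≤ r ∧
          (1 ≤ g₀ ∨ 2 ≤ r) ∧ 1 ≤ g - g₀ ∧
          (∀ c, G.cuspGp c =
            ((PuncturedSurfaceGroup.cuspInertia (g := g) (e c)).map ι).topologicalClosure) ∧
          (∀ w, w = v₀ ∨ w = v₁) ∧ (∀ n, n = n₀) ∧
          ε = ((List.finRange r).map fun j : Fin r =>
            if s ≤ (j : ℕ) then PuncturedSurfaceGroup.c (g := g) j else 1).prod *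
          ((List.finRange g).map fun i : Fin g => if (i : ℕ) < g₀ then
            PuncturedSurfaceGroup.a (r := r) i * PuncturedSurfaceGroup.b i *
              (PuncturedSurfaceGroup.a i)⁻¹ * (PuncturedSurfaceGroup.b i)⁻¹ else 1).prod ∧
          G.vertGp v₀ = ((Subgroup.closure {x : PuncturedSurfaceGroup g r |
            (∃ i : Fin g, (i : ℕ) < g₀ ∧ (x = PuncturedSurfaceGroup.a i ∨ x = PuncturedSurfaceGroup.b i)) ∨
            ∃ j : Fin r, s ≤ (j : ℕ) ∧ x = PuncturedSurfaceGroup.c j}).map ι).topologicalClosure ∧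
          G.vertGp v₁ = ((Subgroup.closure {x : PuncturedSurfaceGroup g r |
            (∃ i : Fin g, g₀ ≤ (i : ℕ) ∧ (x = PuncturedSurfaceGroup.a i ∨ x = PuncturedSurfaceGroup.b i)) ∨
            (∃ j : Fin r, (j : ℕ) < s ∧ x = PuncturedSurfaceGroup.c j) ∨ x = ε}).map ι).topologicalClosure ∧
          G.nodeGp n₀ = ((Subgroup.zpowers ε).map ι).topologicalClosure ∧
          G.genus v₀ = g₀ ∧ G.genus v₁ = g - g₀ :=
    fun Q _ _ _ G hG => hG.2.2
  have hSig : ∀ ⦃Q : Type⦄ [Group Q] [TopologicalSpace Q] [IsTopologicalGroup Q] (G : PSCDatum Q),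
      Ω.IsOfPSCType G → G.Sigma = {l} := fun Q _ _ _ G hG => hG.2.1
  have hl' : ∀ p ∈ ({l} : Set ℕ), p.Prime := fun p hp => by
    rw [Set.mem_singleton_iff.mp hp]; exact hl
  refine ⟨Ω, ?_, openInterDeterminesComponentHolds_of_twoComponentUnmarked Ω hΩ,
    cuspidalEdgeLikeCharacterizationHolds_of_cuspidallyStandard Ω (fun Q _ _ _ G hG => ?_),
    numericallyCuspidalIffHolds_of_twoComponentUnmarked Ω l hΩ hSig⟩
  · obtain ⟨Q, ι, G, e, v₀, v₁, n₀, ε, hι, hS, hi, hn, hr, hC, hV, hN, hε, hV₀, hV₁, hE, hgen₀, hgen₁,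
      -, hce⟩ := exists_twoComponentAffineDatum {l} ⟨l, rfl⟩ hl' 2 1 1 0
    have hG : Ω.IsOfPSCType G := ⟨inferInstance, hS, inferInstance, inferInstance, inferInstance, {l}, 2, 1,
      1, 0, ι, e, v₀, v₁, n₀, ε, ⟨l, rfl⟩, hl', hι, by norm_num, rfl, le_rfl, Or.inl le_rfl, by norm_num,
      hC, hV, hN, hε, hV₀, hV₁, hE, hgen₀, hgen₁⟩
    exact ⟨Q, ι, G, e, v₀, v₁, hι, hG, hS, hi, hn, hr, hV, hgen₀, hgen₁,
      fun c h => absurd ((hce c).mp h) (Nat.not_lt_zero _), hC⟩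
  · obtain ⟨hc, ht, hd, S, g, r, g₀, s, ι, e, v₀, v₁, n₀, ε, hne, hprime, hι, hg₀, hs, hr, hst₀, hg₁, hC,
      -⟩ := hΩ G hG
    exact ⟨hc, ht, hd, S, g, r, ι, e, hne, hprime,
      by unfold PuncturedSurfaceGroup.IsHyperbolicType; omega, hι, hC⟩

end PSCDatum

end Literature.AnabelianGeometry.SemiGraphs

end
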